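import Summits.BirchSwinnertonDyer.BirchSwinnertonDyer.Theorems.ByReductionTypeAtTwoOrdMissingLowerBoundOfLambdaHalf
import Summits.BirchSwinnertonDyer.BirchSwinnertonDyer.Theorems.ByReductionTypeAtTwoOrdEisensteinHalfEquivalence
import Summits.BirchSwinnertonDyer.BirchSwinnertonDyer.Theorems.ByReductionTypeAtTwoMultUpperHalfParity
import Summits.BirchSwinnertonDyer.Rank1Residual.F1Sign2.BranchCongruenceModTwoAtTwo
import Literature.NumberTheory.EllipticCurves.ModularCurvePeriodRatio
import HarnessLib

/-!
# Sketch — crux-ideate 2/2 on item stmt-BirchSwinnertonDyer-19577 `OrdMissingLowerBoundAtTwo`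

First lemmas of the two idea cards (they ELABORATE; §A.1–A.3 and §B are moreover PROVED here):

* §A  card `kato-free-lower-sandwich-two`: the descent crux needs NO Kato crux — Kato 17.4 (1)(2) AT 2
  (PRINT), the `λ`-half (S3 item 19556) and the analytic statement `μ(ϖ·L₂) ≤ 0` give the Eisenstein
  divisibility, hence `MissingLowerBoundAt W 2`, because `μ(X) ≥ 0` is free (Weierstrass-preparation
  sandwich with slack).  §A.4 states the supply of the analytic input on the `E[2]`-irreducible locus from
  the NAMED tree conjecture `F1Sign2.AnalyticMuZeroAtTwo` + Abbes–Ullmo (PRINT named fact).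
* §B  card `square-parity-upgrade-two`: a defect-ONE lower bound plus the parity of `ord₂ #Ш_an` give the
  crux, by Cassels–Tate evenness of `ord₂ #Ш`.

Nothing is asserted; BSD is not proved by any of this.
-/

set_option autoImplicit false
set_option linter.dupNamespace false

noncomputable section

open scoped Classical MatrixGroups ModularForm

open CongruenceSubgroup WeierstrassCurve Literature.NumberTheory.EllipticCurves
  Literature.NumberTheory.EllipticCurves.ModularForms Literature.NumberTheory.EllipticCurves.Rank1Residual
  Literature.NumberTheory.EllipticCurves.Rank1Residual.Typed
  Literature.NumberTheory.EllipticCurves.Greenberg1999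
  Summit.BirchSwinnertonDyer.Rank1Residual.X1.MuLambda
  Summit.BirchSwinnertonDyer.Rank1Residual.X1.MuPart
  Summit.BirchSwinnertonDyer.Rank1Residual.X5
  Summit.BirchSwinnertonDyer.Rank1Residual.X5.O1
  Summit.BirchSwinnertonDyer.Rank1Residual
  Summit.BirchSwinnertonDyer.BirchSwinnertonDyer.Theorems.TwoAdicTwistConverse
  Summit.BirchSwinnertonDyer.BirchSwinnertonDyer.Theorems.EisensteinLowerBounds
  Summit.BirchSwinnertonDyer.BirchSwinnertonDyer.Theorems.EisensteinShaCurrency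
  Summit.BirchSwinnertonDyer.BirchSwinnertonDyer.Theorems.IsogenyMuShift

namespace Summit.BirchSwinnertonDyer.BirchSwinnertonDyer.Cruxes.OrdMissingLowerBoundAtTwo.KatoFreeSandwich

variable (W : WeierstrassCurve ℚ) [W.IsElliptic] [W.IsGloballyMinimal]

/-! ## §A.0 The analytic input, typed: `μ(ϖ·L₂(E)) ≤ 0` (Néron normalisation, slack form) -/

/-- **`μ_an^{Nér}(E) ≤ 0`**: for the newform `f`, the Néron ratio `ϖ` (`ϖ·Ω_E = Ω⁺_f`) and every INTEGRAL
`2`-power multiple `ι L₀ = 2ʲ·ϖ·L₂(f,α)`, `μ(L₀) ≤ j` — i.e. the Néron-normalised `2`-adic `L`-function is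
NOT divisible by `2` in `Λ[1/2]`.  No integrality of `ϖ·L₂` is asked.  Implied by `AnalyticMuLE W 2 0`
(coefficient form) and, on the `E[2]`-irreducible locus, by `F1Sign2.AnalyticMuZeroAtTwo` + Abbes–Ullmo (§A.4). -/
def AnalyticMuNonpos : Prop :=
  ∀ [NeZero (W.conductorNorm ℤ)] (f : CuspForm (Gamma0 (W.conductorNorm ℤ)) 2), IsNewformOf W f →
    ∀ (ϖ : ℚ), (ϖ : ℝ) * W.realPeriodRat = plusPeriod f →
    ∀ (j : ℕ) (L₀ : IwasawaAlgebra 2),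
      iwasawaToPowerSeries 2 L₀ =
        PowerSeries.C (((2 : ℚ) ^ j * ϖ : ℚ) : ℚ_[2]) * padicLFunction f (unitRoot W 2 : ℚ_[2]) →
      mu L₀ ≤ j

/-! ## §A.1 FIRST LEMMA (card 1): Eisenstein divisibility WITHOUT the Kato half -/

/-- **Eisenstein divisibility at `W` from Kato 17.4 (1)(2) AT `2`, the `λ`-half and `μ_an^{Nér} ≤ 0`.**
NO Kato–Néron half (item 19573), NO period integrality `0 ≤ ord₂ ϖ`, NO `μ(X) = 0`: the `μ`-inequality with
slack `μ(L₀) ≤ μ(X) + j` is FREE from `μ(L₀) ≤ j` because `μ(X) ≥ 0`. -/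
theorem eisenstein_of_kato_of_lambdaHalf_of_analyticMuNonpos
    (h17 : ∀ [NeZero (W.conductorNorm ℤ)] (f : CuspForm (Gamma0 (W.conductorNorm ℤ)) 2),
      kato_divisibility_allPrimes W 2 (f := f))
    (hL : LambdaHalfAtTwo W) (hμ : AnalyticMuNonpos W) :
    MainConjectureEisensteinDivisibilityAtTwo W := by
  intro κ γ hκ hγ hγ' hord _ f hf ϖ hϖ D fX hchar
  have hϖ0 : ϖ ≠ 0 := by
    rintro rfl
    have hper : 0 < plusPeriod f := IsNewform0.plusPeriod_pos_holds hf.1 hf.coeffField_eq_bot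
    rw [← hϖ, Rat.cast_zero, zero_mul] at hper
    exact lt_irrefl _ hper
  obtain ⟨j, L₀, hL₀0, hL₀⟩ := exists_integral_slack W hord hf hϖ0
  have hμL₀ : mu L₀ ≤ j := hμ f hf ϖ hϖ j L₀ hL₀
  obtain ⟨c, L₁, hL₁0, hL₁, hlamL₁⟩ := hL κ γ hκ hγ hγ' hord f hf D
  have hlam : lam L₀ = lam L₁ := lam_eq_of_eq_C_mul hL₀0 hL₁0 hL₀ hL₁
  exact (eisensteinAtDatum_iff_lam_le_and_mu_le_slack W (h17 f) hκ hγ hγ' hord hf D hchar hL₀0 hL₀).mpr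
    ⟨hlam ▸ hlamL₁, hμL₀.trans (Nat.le_add_left j D.mu)⟩

/-! ## §A.2 Item 19577 AT `W` without the Kato half -/

/-- **`MissingLowerBoundAt W 2` (item 19577 AT `W`) from PRINT + `λ`-half + `μ_an^{Nér} ≤ 0`** (analytic rank `0`,
good ordinary at `2`), through the X5 door `missingLowerBoundAt_two_of_eisenstein_of_kato`. -/
theorem missingLowerBoundAt_two_of_lambdaHalf_of_analyticMuNonpos
    (hmod : nonempty_modularParametrizationData) (hGZK : rank_eq_analyticRank_of_analyticRank_le_one)
    (h17 : ∀ [NeZero (W.conductorNorm ℤ)] (f : CuspForm (Gamma0 (W.conductorNorm ℤ)) 2),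
      kato_divisibility_allPrimes W 2 (f := f))
    (hEC : TwoAdicEulerCharRankZero W 0) (hgo : GoodOrd W 2) (hr : W.analyticRank = 0)
    (hL : LambdaHalfAtTwo W) (hμ : AnalyticMuNonpos W) : MissingLowerBoundAt W 2 :=
  missingLowerBoundAt_two_of_eisenstein_of_kato W hEC hmod hGZK h17 hr hgo
    (eisenstein_of_kato_of_lambdaHalf_of_analyticMuNonpos W h17 hL hμ)

/-! ## §A.3 The `∀`-closure: 19577 ⟸ PUB ∧ Cassels ∧ 19556 ∧ (a `μ_an^{Nér} ≤ 0` member per class) — no 19573 -/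

/-- **K4's descent crux from S3's `λ`-crux and an analytic witness per class — the Kato crux dropped.**
Compare the tree's `ordMissingLowerBoundAtTwo_of_katoHalfIso_of_lambdaHalf` (which also assumes item 19573). -/
theorem ordMissingLowerBoundAtTwo_of_lambdaHalf_of_muWitness
    (hPub : Literature.Uncategorized.OrdPublishedInputsAtTwo) (hCassels : bsdRHS_eq_of_isIsogenous)
    (hΛ : Summit.BirchSwinnertonDyer.BirchSwinnertonDyer.Theorems.TwoAdicTwistConverse.OrdLambdaHalfAtTwo)
    (hμ : ∀ (W : WeierstrassCurve ℚ) [W.IsElliptic] [W.IsGloballyMinimal], ¬ W.HasCM →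
      W.analyticRank = 0 → GoodOrd W 2 →
      ∃ (W'' : WeierstrassCurve ℚ) (_ : W''.IsElliptic) (_ : W''.IsGloballyMinimal),
        IsIsogenous W W'' ∧ AnalyticMuNonpos W'') :
    Summit.BirchSwinnertonDyer.BirchSwinnertonDyer.Theorems.OrdHalvesAtTwo.OrdMissingLowerBoundAtTwo := by
  have hPub' := hPub
  obtain ⟨hmod, hGZK, h17, hGr⟩ := hPub'
  intro W _ _ hcm hr hgo
  obtain ⟨W'', _, _, hiso'', hμ''⟩ := hμ W hcm hr hgo
  have hcm'' : ¬ W''.HasCM := fun h => hcm ((X12.hasCM_iff_of_isIsogenous hiso'').mpr h)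
  have hr'' : W''.analyticRank = 0 := by rw [← analyticRank_eq_of_isIsogenous' hiso'']; exact hr
  have hgo'' : GoodOrd W'' 2 := isOrdinaryAt_of_isIsogenous hiso'' hgo
  exact missingLowerBoundAt_two_of_isIsogenous W hCassels hGZK hmod hr hiso''
    (missingLowerBoundAt_two_of_lambdaHalf_of_analyticMuNonpos W'' hmod hGZK (h17 W'')
      (twoAdicEulerCharRankZero_zero_of_greenberg W'' hGr) hgo'' hr'' (hΛ W'' hcm'' hgo'') hμ'')

/-- The same with the ROUTE DECLS of `Theses.ByReductionTypeAtTwo` by name (items 19149-PUB, 19556, 19577). -/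
theorem ordMissingLowerBoundAtTwo_of_lambdaHalf_of_muWitness_route
    (hPub : Summit.BirchSwinnertonDyer.BirchSwinnertonDyer.Theses.ByReductionTypeAtTwo.OrdPublishedInputsAtTwo)
    (hCassels : bsdRHS_eq_of_isIsogenous)
    (hΛ : Summit.BirchSwinnertonDyer.BirchSwinnertonDyer.Theses.TwoAdicConverse.OrdLambdaHalfAtTwo)
    (hμ : ∀ (W : WeierstrassCurve ℚ) [W.IsElliptic] [W.IsGloballyMinimal], ¬ W.HasCM →
      W.analyticRank = 0 → GoodOrd W 2 →
      ∃ (W'' : WeierstrassCurve ℚ) (_ : W''.IsElliptic) (_ : W''.IsGloballyMinimal),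
        IsIsogenous W W'' ∧ AnalyticMuNonpos W'') :
    Summit.BirchSwinnertonDyer.BirchSwinnertonDyer.Theses.ByReductionTypeAtTwo.OrdMissingLowerBoundAtTwo :=
  ordMissingLowerBoundAtTwo_of_lambdaHalf_of_muWitness hPub hCassels hΛ hμ

/-! ## §A.4 Supply of the analytic input on the `E[2]`-IRREDUCIBLE locus -/

/-- **Irreducible-locus supply (STATEMENT).** Granted Abbes–Ullmo/GV Rem. 3.4 at `2` (PRINT named fact
`realPeriodRat_eq_unit_mul_plusPeriod_two`: `ϖ` is a `2`-adic unit when `2 ∤ N` and `E[2]` is irreducible), the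
NAMED tree conjecture `F1Sign2.AnalyticMuZeroAtTwo` (`μ(L₂(f,α)) = 0`, crux IMC-K2μ of cell bsd-f1-sign2) gives
`AnalyticMuNonpos W` at EVERY good-ordinary member with `E[2]` irreducible — so on that locus 19577 needs no
isogeny move and no per-class witness. -/
def IrreducibleSupply : Prop :=
  realPeriodRat_eq_unit_mul_plusPeriod_two →
  Summit.BirchSwinnertonDyer.Rank1Residual.F1Sign2.AnalyticMuZeroAtTwo →
  ∀ (W : WeierstrassCurve ℚ) [W.IsElliptic] [W.IsGloballyMinimal],
    IsOrdinaryAt W 2 → W.HasIrreducibleModPGaloisRep 2 →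
    (∀ x : ℚ, ¬ HasRationalTwoTorsionX W x) → AnalyticMuNonpos W

/-- **PROOF of the irreducible-locus supply.** `ϖ` is a `2`-adic unit (Abbes–Ullmo), `L₂(f,α) = ι G` with
`G ∉ 2Λ` (the conjecture), so `L₀ = 2ʲ·ϖ̃·G` with `ϖ̃ ∈ ℤ₂ˣ` and `μ(L₀) = j`. -/
theorem irreducibleSupply_holds : IrreducibleSupply := by
  intro hAU hAμ W _ _ hord hirr h2 _ f hf ϖ hϖ j L₀ hL₀
  obtain ⟨u, hu, hΩ⟩ := hAU W hord.1 hirr f hf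
  have hϖv : padicValRat 2 ϖ = 0 :=
    Rank1Residual.padicValRat_periodRatio_eq_zero_of_eq_unit_mul W 2 f hu hΩ ϖ hϖ
  have hϖ0 : ϖ ≠ 0 := by
    rintro rfl
    have hper : 0 < plusPeriod f := IsNewform0.plusPeriod_pos_holds hf.1 hf.coeffField_eq_bot
    rw [← hϖ, Rat.cast_zero, zero_mul] at hper
    exact lt_irrefl _ hper
  have hnorm : ‖(ϖ : ℚ_[2])‖ = 1 := by
    rw [Padic.eq_padicNorm, padicNorm.eq_zpow_of_nonzero hϖ0, hϖv, neg_zero, zpow_zero, Rat.cast_one]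
  have hvc : ((PadicInt.mkUnits hnorm : ℤ_[2]ˣ) : ℤ_[2]) = (⟨(ϖ : ℚ_[2]), hnorm.le⟩ : ℤ_[2]) := by
    simp [PadicInt.mkUnits]
  have hvc' : (((PadicInt.mkUnits hnorm : ℤ_[2]ˣ) : ℤ_[2]) : ℚ_[2]) = (ϖ : ℚ_[2]) := by
    rw [hvc]
  obtain ⟨G, hG⟩ := exists_integral_mul_padicLFunction_two_of_padicValRat_nonneg (W := W) hord hf
    (ϖ := 1) (by simp)
  have hG' : iwasawaToPowerSeries 2 G = padicLFunction f (unitRoot W 2 : ℚ_[2]) := by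
    rw [hG, Rat.cast_one, map_one, one_mul]
  have hred : red G ≠ 0 := hAμ W hord h2 f hf G hG'
  have hred₁ : red (PowerSeries.C ((PadicInt.mkUnits hnorm : ℤ_[2]ˣ) : ℤ_[2]) * G) ≠ 0 :=
    red_C_mul_ne_zero_of_isUnit (PadicInt.mkUnits hnorm).isUnit hred
  have hG₁0 : PowerSeries.C ((PadicInt.mkUnits hnorm : ℤ_[2]ˣ) : ℤ_[2]) * G ≠ 0 := by
    intro h0; rw [h0] at hred₁; exact hred₁ (by simp [red])
  have hμ₁ : mu (PowerSeries.C ((PadicInt.mkUnits hnorm : ℤ_[2]ˣ) : ℤ_[2]) * G) = 0 :=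
    (mu_eq_and_pfree_eq hred₁ (by rw [pow_zero, map_one, one_mul])).1
  have hL₀eq : L₀ = PowerSeries.C (((2 : ℕ) : ℤ_[2]) ^ j) *
      (PowerSeries.C ((PadicInt.mkUnits hnorm : ℤ_[2]ˣ) : ℤ_[2]) * G) := by
    have h2c : ((2 : ℤ_[2]) : ℚ_[2]) = 2 := by simpa using (PadicInt.coe_natCast (p := 2) 2)
    apply iwasawaToPowerSeries_injective (p := 2)
    rw [hL₀, ← hG', map_mul, map_mul, iwasawaToPowerSeries_C, iwasawaToPowerSeries_C, ← mul_assoc,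
      ← map_mul, hvc']
    push_cast
    rw [h2c]
  rw [hL₀eq, mu_C_pow_mul hG₁0 j, hμ₁, add_zero]

/-- Consequently (PROVED): on the `E[2]`-irreducible good-ordinary rank-`0` locus, item 19577 AT `W` follows from
PRINT + the `λ`-half at `W` + the NAMED conjecture `AnalyticMuZeroAtTwo` — no Kato crux, no isogeny move. -/
theorem missingLowerBoundAt_two_irr_of_lambdaHalf_of_analyticMuZeroAtTwo
    (hmod : nonempty_modularParametrizationData) (hGZK : rank_eq_analyticRank_of_analyticRank_le_one)
    (h17 : ∀ [NeZero (W.conductorNorm ℤ)] (f : CuspForm (Gamma0 (W.conductorNorm ℤ)) 2),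
      kato_divisibility_allPrimes W 2 (f := f))
    (hEC : TwoAdicEulerCharRankZero W 0) (hAU : realPeriodRat_eq_unit_mul_plusPeriod_two)
    (hAμ : Summit.BirchSwinnertonDyer.Rank1Residual.F1Sign2.AnalyticMuZeroAtTwo)
    (hgo : GoodOrd W 2) (hr : W.analyticRank = 0) (hirr : W.HasIrreducibleModPGaloisRep 2)
    (h2 : ∀ x : ℚ, ¬ HasRationalTwoTorsionX W x) (hL : LambdaHalfAtTwo W) : MissingLowerBoundAt W 2 :=
  missingLowerBoundAt_two_of_lambdaHalf_of_analyticMuNonpos W hmod hGZK h17 hEC hgo hr hL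
    (irreducibleSupply_holds hAU hAμ W hgo hirr h2)

/-- `AnalyticMuLE W 2 0` (coefficient form — the cell's certificate currency, e.g. a unit value
`L(E,χ,1)/Ω` at one `2`-power conductor character) implies the slack form (PROVED: `‖2ʲa‖₂ = 2⁻ʲ‖a‖₂`). -/
def CoefficientFormImpliesSlackForm : Prop :=
  ∀ (W : WeierstrassCurve ℚ) [W.IsElliptic] [W.IsGloballyMinimal], AnalyticMuLE W 2 0 → AnalyticMuNonpos W

theorem coefficientForm_implies_slackForm : CoefficientFormImpliesSlackForm := by
  intro W _ _ hA _ f hf ϖ hϖ j L₀ hL₀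
  obtain ⟨n, hn⟩ := hA f hf ϖ hϖ
  have h2 : ‖(2 : ℚ_[2])‖ = (2 : ℝ)⁻¹ := by
    have h := Padic.norm_p (p := 2)
    exact_mod_cast h
  have hcoeff : PowerSeries.coeff n (iwasawaToPowerSeries 2 L₀) =
      (2 : ℚ_[2]) ^ j * PowerSeries.coeff n
        (PowerSeries.C (ϖ : ℚ_[2]) * padicLFunction f (unitRoot W 2 : ℚ_[2])) := by
    rw [hL₀, PowerSeries.coeff_C_mul, PowerSeries.coeff_C_mul]
    push_cast
    ring
  have key : (2 : ℝ) ^ (-((j : ℤ) + 1)) = ((2 : ℝ)⁻¹) ^ j * (2 : ℝ) ^ (-(1 : ℤ)) := by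
    rw [neg_add, zpow_add₀ two_ne_zero, zpow_neg (2 : ℝ) (j : ℤ), zpow_natCast, inv_pow]
  refine mu_le_of_lt_norm_coeff (p := 2) (n := n) ?_
  simp only [Nat.cast_ofNat, Nat.cast_zero, zero_add] at hn ⊢
  rw [hcoeff, norm_mul, norm_pow, h2, key]
  exact mul_lt_mul_of_pos_left hn (pow_pos (by norm_num) j)

end Summit.BirchSwinnertonDyer.BirchSwinnertonDyer.Cruxes.OrdMissingLowerBoundAtTwo.KatoFreeSandwich

/-! ## §B FIRST LEMMA (card 2): the square-parity upgrade -/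

namespace Summit.BirchSwinnertonDyer.BirchSwinnertonDyer.Cruxes.OrdMissingLowerBoundAtTwo.SquareParityUpgrade

variable (W : WeierstrassCurve ℚ) [W.IsElliptic]

/-- **Defect-`d` lower bound at `p`**: `ord_p #Ш_an ≤ ord_p #Ш[p^∞] + d` (`d = 0` is `MissingLowerBoundAt W p`). -/
def LowerBoundUpToAt (p d : ℕ) : Prop :=
  ∃ q : ℚ, shaAn W = (q : ℂ) ∧ padicValRat p q ≤ (padicValNat p W.shaOrder : ℤ) + d

/-- **Analytic square-parity at `p`**: `ord_p #Ш_an(E)` is EVEN (BSD predicts `#Ш_an = #Ш`, a square by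
Cassels–Tate; as an analytic statement it is OPEN class-wide — the card's lever is its TRANSPORT along
Kohnen–Zagier / Baruch–Mao quadratic-twist families, where `L^{alg}(E^D,1) = κ_E · c(|D|)²`). -/
def ShaAnEvenOrdAt (p : ℕ) : Prop :=
  ∃ q : ℚ, shaAn W = (q : ℂ) ∧ Even (padicValRat p q)

/-- **FIRST LEMMA (card 2, PROVED): defect one + analytic parity + Cassels–Tate ⟹ the crux inequality at `W`.**
`ord₂ #Ш` is even (`even_padicValNat_shaOrder_of_casselsTate`, `Ш` finite), `ord₂ #Ш_an` is even (hypothesis),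
and an even integer `≤` an even integer `+ 1` is `≤` it. -/
theorem missingLowerBoundAt_of_upToOne_of_even
    (hCT : WeierstrassCurve.exists_casselsTate_pairing (K := ℚ)) (hfin : Finite W.sha)
    (h1 : LowerBoundUpToAt W 2 1) (hpar : ShaAnEvenOrdAt W 2) : MissingLowerBoundAt W 2 := by
  obtain ⟨q, hq, hle⟩ := h1
  obtain ⟨q', hq', hev⟩ := hpar
  have hqq : q' = q := by
    have h : ((q' : ℚ) : ℂ) = ((q : ℚ) : ℂ) := by rw [← hq', ← hq]
    exact_mod_cast h
  rw [hqq] at hev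
  obtain ⟨a, ha⟩ := Theorems.even_padicValNat_shaOrder_of_casselsTate hCT W hfin 2
  obtain ⟨b, hb⟩ := hev
  refine ⟨q, hq, ?_⟩
  have ha' : ((padicValNat 2 W.shaOrder : ℕ) : ℤ) = (a : ℤ) + (a : ℤ) := by exact_mod_cast ha
  simp only [Nat.cast_one] at hle
  omega

end Summit.BirchSwinnertonDyer.BirchSwinnertonDyer.Cruxes.OrdMissingLowerBoundAtTwo.SquareParityUpgrade

end
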